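import Literature.Analysis.FluidPDE.NSEnergyClassLevelN
import HarnessLib

/-!
# The energy equality of weak Navier–Stokes solutions in the energy class with
  `∫₀ᵀ‖u‖₄⁴ < ∞` on `T^d`, `2 ≤ d ≤ 4`

Analysis/FluidPDE file (theorem-only), conclusion of `NSEnergyClassSlice` / `NSEnergyClassLevelN`.
Let `u` be a forced weak Navier–Stokes solution on `T^d × [0, T)`, `2 ≤ d ≤ 4`, in the energy
class — `Torus.IsWeakNSSolutionForcedOn T ν f u₀ u`, `u ∈ L^∞(0,T;L²)` (a.e. bound), `L²` slices
on `[0, T]`, `u ∈ L²(0,T;H¹)` spectrally, weakly `L²`-continuous on `(0, T]` with weak limit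
`u₀ ∈ L²` at `0⁺` — with `∫₀ᵀ‖u‖₄⁴ < ∞` and a jointly measurable force `f ∈ L¹(0,T;L²)`. Then
(Lions 1960; Shinbrot 1974; in two dimensions Lions–Prodi 1959, where `∫₀ᵀ‖u‖₄⁴ < ∞` is
automatic by Ladyzhenskaya's inequality, see `Literature/Analysis/FluidPDE/NSEnergyEquality2D`):

* `tendsto_setIntegral_inner_convect_fourierTruncate_self` — the nonlinear term of the truncated
  identity vanishes in the limit;
* `energy_eq_zero` — `½‖u(t)‖² + ν∫₀ᵗ‖∇u‖₂² = ½‖u₀‖² + ∫₀ᵗ∫⟪f,u⟫` for every `t ∈ (0, T]`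
  (the proof of `lions_energy_equality_Ioc`, `DuchonRobertLionsEnergyEquality`, which is keyed
  on `Torus.IsLerayHopfOn` but never uses its energy inequalities, run on the unbundled
  hypotheses);
* `integrableOn_work_L1L2`, `energy_eq_of_mem_Ioc` — the work is integrable in time and the
  equality holds between any two times `0 < s ≤ t ≤ T`;

The strong initial trace, the packaging as a Leray–Hopf solution (`Torus.IsLerayHopfOn`) of `u`
re-defined at `t = 0` by its datum, and the two-dimensional corollary follow in
`Literature/Analysis/FluidPDE/NSEnergyClassLerayHopf` and `NSEnergyEquality2D`.

## References

* J.-L. Lions, G. Prodi, *Un théorème d'existence et unicité dans les équations de Navier–Stokes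
  en dimension 2*, C. R. Acad. Sci. Paris 248 (1959), 3519–3521.
* J.-L. Lions, Rend. Sem. Mat. Univ. Padova 30 (1960), 16–23; M. Shinbrot, SIAM J. Math. Anal. 5
  (1974), 948–954. [Shinbrot1974]
* R. Temam, *Navier–Stokes Equations*, 3rd ed., North-Holland 1984, Ch. III, Thm. 3.2 and
  Lemma 1.2. [Temam1984]
-/

noncomputable section

open MeasureTheory TopologicalSpace Set Function Filter Topology UnitAddTorus
open scoped InnerProductSpace RealInnerProductSpace ENNReal NNReal ContDiff

namespace Literature.Analysis.FluidPDE

namespace Torus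

namespace WeakNSEnergyClass

variable {d : Type*} [Fintype d] [DecidableEq d]

variable {T ν : ℝ} {f u : ℝ → UnitAddTorus d → EuclideanSpace ℝ d}
  {u₀ : UnitAddTorus d → EuclideanSpace ℝ d}

/-! ### The nonlinear term in the limit `N → ∞` -/

/-- **The nonlinear term of the truncated identity vanishes in the limit** (Lions 1960; Shinbrot
1974, the step `∫∫ (u·∇)u · u_h → ∫∫ (u·∇)u · u = 0`): for an energy-class weak solution
on `T^d`, `2 ≤ d ≤ 4`, with `∫₀ᵀ‖u‖₄⁴ < ∞`, and every `t ∈ (0, T]`,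
`∫_{(0,t]} ∫⟪u, (u·∇)P_N u⟫ ds → 0` as `N → ∞` — dominated convergence in time: the slice term
tends to `0` (`Torus.enorm_integral_inner_convect_fourierTruncate_self_le` with the `L⁴`
truncation error of an `H¹` slice, `Torus.tendsto_lintegral_enorm_pow_four_fourierTruncate_sub_of_card_le_four`)
and is dominated by `‖u(s)‖₄² ‖∇u(s)‖₂ ∈ L¹(0,T)` (Cauchy–Schwarz in time); energy-class twin of
`Torus.IsLerayHopfOn.tendsto_setIntegral_inner_convect_fourierTruncate_self`. [cite: Shinbrot1974, Thm. (proof)] -/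
theorem tendsto_setIntegral_inner_convect_fourierTruncate_self (hd2 : 2 ≤ Fintype.card d) (hd4 : Fintype.card d ≤ 4)
    (hw : IsWeakNSSolutionForcedOn T ν f u₀ u)
    (hL2 : ∀ t ∈ Icc 0 T, MemLp (u t) 2 volume)
    (hH1 : FunctionSpaces.Torus.MemL2Sobolev 0 T 1 (fun t => FunctionSpaces.EuclideanSpace.complexify ∘ u t))
    (hwc : ∀ w : UnitAddTorus d → EuclideanSpace ℝ d, MemLp w 2 volume →
      ContinuousOn (fun t => ∫ x, ⟪u t x, w x⟫) (Ioc 0 T) ∧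
        Tendsto (fun t => ∫ x, ⟪u t x, w x⟫) (𝓝[>] 0) (𝓝 (∫ x, ⟪u₀ x, w x⟫)))
    (hL4 : ∫⁻ s in Ioo 0 T, ∫⁻ x, ‖u s x‖ₑ ^ 4 < ⊤)
    {t : ℝ} (ht : t ∈ Ioc 0 T) :
    (∀ N, IntegrableOn (fun s =>
        ∫ x, ⟪u s x, FunctionSpaces.Torus.convect (u s) (FunctionSpaces.Torus.fourierTruncate N (u s)) x⟫) (Ioc 0 t)) ∧
    Tendsto (fun N => ∫ s in Ioc 0 t,
        ∫ x, ⟪u s x, FunctionSpaces.Torus.convect (u s) (FunctionSpaces.Torus.fourierTruncate N (u s)) x⟫)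
      atTop (𝓝 0) := by
  set μT : Measure ℝ := volume.restrict (Ioo 0 T) with hμT
  set μt : Measure ℝ := volume.restrict (Ioo 0 t) with hμt
  have hsub : Ioo 0 t ⊆ Ioo 0 T := Ioo_subset_Ioo le_rfl ht.2
  have hle : μt ≤ μT := Measure.restrict_mono hsub le_rfl
  -- ### time densities
  set U4 : ℝ → ℝ≥0∞ := fun s => ∫⁻ x, ‖u s x‖ₑ ^ 4 with hU4
  set g : ℝ → ℝ≥0∞ := fun s => FunctionSpaces.Torus.eGradNormSq (u s) with hg
  set B : ℝ → ℝ≥0∞ := fun s => U4 s ^ (1 / 2 : ℝ) * g s ^ (1 / 2 : ℝ) with hB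
  set F : ℕ → ℝ → ℝ := fun N s =>
    ∫ x, ⟪u s x, FunctionSpaces.Torus.convect (u s) (FunctionSpaces.Torus.fourierTruncate N (u s)) x⟫ with hF
  -- ### measurability
  have hU4m : AEMeasurable U4 μT := aemeasurable_lintegral_enorm_pow hw 4
  have hgm : AEMeasurable g μT := aemeasurable_eGradNormSq hw hL2
  have hBm : AEMeasurable B μT := (hU4m.pow_const _).mul (hgm.pow_const _)
  have hu' := aestronglyMeasurable_uncurry hw
  have hu't : AEStronglyMeasurable (uncurry u) (μt.prod volume) :=
    hu'.mono_measure (Measure.prod_mono hle le_rfl)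
  have hFm : ∀ N, AEStronglyMeasurable (F N) μt := fun N =>
    aestronglyMeasurable_integral_inner_convect_fourierTruncate hu't hu't hu't N
  -- ### finiteness
  have hU4fin : ∫⁻ s, U4 s ∂μT < ⊤ := hL4
  have hgfin : ∫⁻ s, g s ∂μT < ⊤ := lintegral_eGradNormSq_lt_top_of_memL2Sobolev hH1
  have hBfin : ∫⁻ s, B s ∂μt ≠ ⊤ := by
    have h := ENNReal.lintegral_mul_le_Lp_mul_Lq μt Real.HolderConjugate.two_two
      ((hU4m.mono_measure hle).pow_const (1 / 2 : ℝ)) ((hgm.mono_measure hle).pow_const (1 / 2 : ℝ))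
    have e : ∀ x : ℝ≥0∞, (x ^ (1 / 2 : ℝ)) ^ (2 : ℝ) = x := fun x => by
      rw [← ENNReal.rpow_mul]; norm_num
    simp only [Pi.mul_apply, e] at h
    refine ne_top_of_le_ne_top (ENNReal.mul_ne_top ?_ ?_) h
    · exact ENNReal.rpow_ne_top_of_nonneg (by norm_num) ((lintegral_mono' hle le_rfl).trans_lt hU4fin).ne
    · exact ENNReal.rpow_ne_top_of_nonneg (by norm_num) ((lintegral_mono' hle le_rfl).trans_lt hgfin).ne
  have hbound_int : Integrable (fun s => (B s).toReal) μt :=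
    integrable_toReal_of_lintegral_ne_top (hBm.mono_measure hle) hBfin
  -- ### a.e. finiteness of the densities on `(0, t)`
  have hU4ae : ∀ᵐ s ∂μt, U4 s < ⊤ := (ae_lt_top' hU4m hU4fin.ne).filter_mono (ae_mono hle)
  have hgae : ∀ᵐ s ∂μt, g s < ⊤ := (ae_lt_top' hgm hgfin.ne).filter_mono (ae_mono hle)
  -- ### domination
  have h_bound : ∀ N, ∀ᵐ s ∂μt, ‖F N s‖ ≤ (B s).toReal := by
    intro N
    filter_upwards [hU4ae, hgae, ae_restrict_mem measurableSet_Ioo] with s hU hG hs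
    have hmem : MemLp (u s) 2 volume := hL2 s (Ioo_subset_Icc_self (hsub hs))
    have h1 := enorm_integral_inner_convect_fourierTruncate_self_le' hmem N
    have hBs : B s ≠ ⊤ := ENNReal.mul_ne_top (ENNReal.rpow_ne_top_of_nonneg (by norm_num) hU.ne)
      (ENNReal.rpow_ne_top_of_nonneg (by norm_num) hG.ne)
    have h2 := ENNReal.toReal_mono hBs h1
    rwa [Real.enorm_eq_ofReal_abs, ENNReal.toReal_ofReal (abs_nonneg _), ← Real.norm_eq_abs] at h2
  -- ### slice convergence for a.e. time
  have h_lim : ∀ᵐ s ∂μt, Tendsto (fun N => F N s) atTop (𝓝 0) := by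
    have hSob : ∀ᵐ s ∂μT, FunctionSpaces.Torus.MemSobolev 1 (FunctionSpaces.EuclideanSpace.complexify ∘ u s) :=
      hH1.1
    filter_upwards [hU4ae, hSob.filter_mono (ae_mono hle), hgae,
      ae_restrict_mem measurableSet_Ioo] with s h4 hS hG hs
    have hsT : s ∈ Ioc 0 T := ⟨hs.1, hs.2.le.trans ht.2⟩
    have hmem : MemLp (u s) 2 volume := hL2 s (Ioc_subset_Icc_self hsT)
    have hdiv := isWeaklyDivFree_of_mem_Ioc hw hwc hsT
    -- the `L⁴` truncation error vanishes
    have hR := tendsto_lintegral_enorm_pow_four_fourierTruncate_sub_of_card_le_four hd2 hd4 hmem hS.2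
    -- finiteness of the fixed factors
    have hU4s : U4 s ≠ ⊤ := h4.ne
    have hfac : U4 s ^ (1 / 4 : ℝ) * g s ^ (1 / 2 : ℝ) ≠ ⊤ :=
      ENNReal.mul_ne_top (ENNReal.rpow_ne_top_of_nonneg (by norm_num) hU4s)
        (ENNReal.rpow_ne_top_of_nonneg (by norm_num) hG.ne)
    -- the bound and its limit
    have hbd : ∀ N, ‖F N s‖ₑ ≤ (∫⁻ x, ‖FunctionSpaces.Torus.fourierTruncate N (u s) x - u s x‖ₑ ^ 4) ^ (1 / 4 : ℝ) *
        (U4 s ^ (1 / 4 : ℝ) * g s ^ (1 / 2 : ℝ)) := fun N => by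
      rw [← mul_assoc]
      exact enorm_integral_inner_convect_fourierTruncate_self_le hmem hdiv N
    have hlim0 : Tendsto (fun N => (∫⁻ x, ‖FunctionSpaces.Torus.fourierTruncate N (u s) x - u s x‖ₑ ^ 4) ^ (1 / 4 : ℝ) *
        (U4 s ^ (1 / 4 : ℝ) * g s ^ (1 / 2 : ℝ))) atTop (𝓝 0) := by
      have h1 : Tendsto (fun N => (∫⁻ x, ‖FunctionSpaces.Torus.fourierTruncate N (u s) x - u s x‖ₑ ^ 4) ^ (1 / 4 : ℝ))
          atTop (𝓝 0) := by
        have hc := (ENNReal.continuous_rpow_const (y := (1 / 4 : ℝ))).tendsto 0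
        rw [ENNReal.zero_rpow_of_pos (by norm_num)] at hc
        exact hc.comp hR
      have h2 := ENNReal.Tendsto.mul_const h1 (Or.inr hfac)
      rwa [zero_mul] at h2
    have hen : Tendsto (fun N => ‖F N s‖ₑ) atTop (𝓝 0) :=
      tendsto_of_tendsto_of_tendsto_of_le_of_le tendsto_const_nhds hlim0 (fun _ => bot_le) hbd
    -- back to real numbers
    have hnorm : Tendsto (fun N => ‖F N s‖) atTop (𝓝 0) := by
      have h := (ENNReal.tendsto_toReal ENNReal.zero_ne_top).comp hen
      rw [ENNReal.toReal_zero] at h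
      refine h.congr fun N => ?_
      rw [Function.comp_apply, Real.enorm_eq_ofReal_abs, ENNReal.toReal_ofReal (abs_nonneg _), Real.norm_eq_abs]
    exact tendsto_zero_iff_norm_tendsto_zero.2 hnorm
  -- ### integrability and dominated convergence
  have hInt : ∀ N, IntegrableOn (F N) (Ioc 0 t) := fun N => by
    rw [IntegrableOn, ← Measure.restrict_congr_set Ioo_ae_eq_Ioc]
    exact hbound_int.mono' (hFm N) (h_bound N)
  refine ⟨hInt, ?_⟩
  have hDC := tendsto_integral_of_dominated_convergence (fun s => (B s).toReal) hFm hbound_int h_bound h_lim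
  rw [integral_zero] at hDC
  refine hDC.congr fun N => ?_
  rw [hμt, setIntegral_congr_set Ioo_ae_eq_Ioc]

/-! ### The energy equality from `0` -/

/-- **The energy equality of an energy-class weak solution with `∫₀ᵀ‖u‖₄⁴ < ∞`, from `0`**
(Lions 1960; Shinbrot 1974, Thm. with `p = r = 4`; in two dimensions Lions–Prodi 1959 and
Temam 1984, Ch. III, Thm. 3.2): for a forced weak Navier–Stokes solution `u` on `T^d × [0, T)`,
`2 ≤ d ≤ 4`, in `L^∞(0,T;L²)` with `L²` slices, in `L²(0,T;H¹)` spectrally, weakly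
`L²`-continuous on `(0,T]` with weak limit `u₀ ∈ L²` at `0⁺`, with `∫₀ᵀ‖u‖₄⁴ < ∞` and a jointly
measurable force `f ∈ L¹(0,T;L²)`, for **every `t ∈ (0, T]`**
`½‖u(t)‖² + ν ∫₀ᵗ ‖∇u‖₂² = ½‖u₀‖² + ∫₀ᵗ∫ ⟪f, u⟫`.
Proof verbatim that of `lions_energy_equality_Ioc` (Galerkin/Fourier-truncation form of the
Lions–Shinbrot argument), on the unbundled hypotheses. [cite: Shinbrot1974, Thm. (p = r = 4: Lions 1960)] -/
theorem energy_eq_zero (hd2 : 2 ≤ Fintype.card d) (hd4 : Fintype.card d ≤ 4)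
    (hw : IsWeakNSSolutionForcedOn T ν f u₀ u)
    (hE : ∃ C : ℝ≥0, ∀ᵐ t ∂(volume.restrict (Ioo 0 T)), ∫⁻ x, ‖u t x‖ₑ ^ 2 ≤ C)
    (hL2 : ∀ t ∈ Icc 0 T, MemLp (u t) 2 volume)
    (hH1 : FunctionSpaces.Torus.MemL2Sobolev 0 T 1 (fun t => FunctionSpaces.EuclideanSpace.complexify ∘ u t))
    (hwc : ∀ w : UnitAddTorus d → EuclideanSpace ℝ d, MemLp w 2 volume →
      ContinuousOn (fun t => ∫ x, ⟪u t x, w x⟫) (Ioc 0 T) ∧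
        Tendsto (fun t => ∫ x, ⟪u t x, w x⟫) (𝓝[>] 0) (𝓝 (∫ x, ⟪u₀ x, w x⟫)))
    (hu₀ : MemLp u₀ 2 volume) (hL4 : ∫⁻ s in Ioo 0 T, ∫⁻ x, ‖u s x‖ₑ ^ 4 < ⊤)
    (hfm : AEStronglyMeasurable (FunctionSpaces.Torus.stLift f) (volume.restrict (Ioo 0 T ×ˢ univ)))
    (hf : MemLqLp 1 2 f (Ioo 0 T)) :
    ∀ t ∈ Ioc 0 T,
      FunctionSpaces.Torus.kineticEnergy (u t) + ν * (∫⁻ τ in Ioo 0 t, FunctionSpaces.Torus.eGradNormSq (u τ)).toReal =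
        FunctionSpaces.Torus.kineticEnergy u₀ + ∫ τ in 0..t, ∫ x, ⟪f τ x, u τ x⟫ := by
  intro t ht
  have hT : 0 < T := ht.1.trans_le ht.2
  have ht' : t ∈ Icc 0 T := ⟨ht.1.le, ht.2⟩
  -- ### the five sequences
  set L : ℕ → ℝ := fun N => ∫ x, ⟪FunctionSpaces.Torus.fourierTruncate N (u t) x, FunctionSpaces.Torus.fourierTruncate N (u t) x⟫ with hL
  set L₀ : ℕ → ℝ := fun N => ∫ x, ⟪FunctionSpaces.Torus.fourierTruncate N u₀ x, FunctionSpaces.Torus.fourierTruncate N u₀ x⟫ with hL₀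
  set NL : ℕ → ℝ := fun N => ∫ s in Ioc 0 t,
    ∫ x, ⟪u s x, FunctionSpaces.Torus.convect (u s) (FunctionSpaces.Torus.fourierTruncate N (u s)) x⟫ with hNL
  set D : ℕ → ℝ := fun N => ∫ s in Ioc 0 t,
    (FunctionSpaces.Torus.eGradNormSq (FunctionSpaces.Torus.fourierTruncate N (u s))).toReal with hD
  set W : ℕ → ℝ := fun N => ∫ s in Ioc 0 t, ∫ x, ⟪f s x, FunctionSpaces.Torus.fourierTruncate N (u s) x⟫ with hW
  obtain ⟨hNLint, hNLlim⟩ := tendsto_setIntegral_inner_convect_fourierTruncate_self hd2 hd4 hw hL2 hH1 hwc hL4 ht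
  obtain ⟨hDint, hDlim⟩ := tendsto_setIntegral_toReal_eGradNormSq_fourierTruncate hw hL2 hH1 ht
  obtain ⟨hWint, hWlim⟩ := tendsto_setIntegral_work_fourierTruncate hw hE hL2 hfm hf ht
  -- ### the identity at level `N`
  have hN : ∀ N, L N = L₀ N + 2 * ((NL N - ν * D N) + W N) := by
    intro N
    obtain ⟨hΦint, hid⟩ := integral_inner_fourierTruncate_self_eq hw hE hL2 hwc hT hfm hf hu₀ N ht
    -- split the flux for a.e. `s ∈ (0, t]`
    have h1 : ∀ᵐ s ∂(volume.restrict (Ioc 0 T)), Integrable (f s) volume := by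
      rw [← Measure.restrict_congr_set Ioo_ae_eq_Ioc]
      exact ae_integrable_force_slice' hf
    have hsplit : ∀ᵐ s ∂(volume.restrict (Ioc 0 t)),
        (∫ x, (⟪u s x, FunctionSpaces.Torus.convect (u s) (FunctionSpaces.Torus.fourierTruncate N (u s)) x⟫ +
          ν * ⟪u s x, FunctionSpaces.Torus.laplacian (FunctionSpaces.Torus.fourierTruncate N (u s)) x⟫ +
          ⟪f s x, FunctionSpaces.Torus.fourierTruncate N (u s) x⟫)) =
        (∫ x, ⟪u s x, FunctionSpaces.Torus.convect (u s) (FunctionSpaces.Torus.fourierTruncate N (u s)) x⟫) -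
          ν * (FunctionSpaces.Torus.eGradNormSq (FunctionSpaces.Torus.fourierTruncate N (u s))).toReal +
          ∫ x, ⟪f s x, FunctionSpaces.Torus.fourierTruncate N (u s) x⟫ := by
      filter_upwards [ae_restrict_of_ae_restrict_of_subset (Ioc_subset_Ioc_right ht.2) h1,
        ae_restrict_mem measurableSet_Ioc] with s hs hsI
      exact flux_fourierTruncate_self_split (hL2 s ⟨hsI.1.le, hsI.2.trans ht.2⟩) hs ν N
    have iD : IntegrableOn (fun s => ν * (FunctionSpaces.Torus.eGradNormSq (FunctionSpaces.Torus.fourierTruncate N (u s))).toReal)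
        (Ioc 0 t) := (hDint N).const_mul ν
    have iND : IntegrableOn (fun s =>
        (∫ x, ⟪u s x, FunctionSpaces.Torus.convect (u s) (FunctionSpaces.Torus.fourierTruncate N (u s)) x⟫) -
          ν * (FunctionSpaces.Torus.eGradNormSq (FunctionSpaces.Torus.fourierTruncate N (u s))).toReal) (Ioc 0 t) :=
      (hNLint N).sub iD
    rw [hL, hL₀, hNL, hD, hW]
    dsimp only
    rw [hid, integral_congr_ae hsplit, integral_add iND (hWint N), integral_sub (hNLint N) iD, integral_const_mul]
  -- ### the limits
  have hLlim : Tendsto L atTop (𝓝 (∫ x, ‖u t x‖ ^ 2)) := tendsto_integral_inner_fourierTruncate_self (hL2 t ht')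
  have hL₀lim : Tendsto L₀ atTop (𝓝 (∫ x, ‖u₀ x‖ ^ 2)) := tendsto_integral_inner_fourierTruncate_self hu₀
  have hRlim : Tendsto (fun N => L₀ N + 2 * ((NL N - ν * D N) + W N)) atTop
      (𝓝 ((∫ x, ‖u₀ x‖ ^ 2) + 2 * ((0 - ν * (∫⁻ s in Ioo 0 t, FunctionSpaces.Torus.eGradNormSq (u s)).toReal) +
        ∫ s in Ioc 0 t, ∫ x, ⟪f s x, u s x⟫))) :=
    hL₀lim.add (((hNLlim.sub (hDlim.const_mul ν)).add hWlim).const_mul 2)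
  have hLlim' : Tendsto L atTop
      (𝓝 ((∫ x, ‖u₀ x‖ ^ 2) + 2 * ((0 - ν * (∫⁻ s in Ioo 0 t, FunctionSpaces.Torus.eGradNormSq (u s)).toReal) +
        ∫ s in Ioc 0 t, ∫ x, ⟪f s x, u s x⟫))) :=
    hRlim.congr fun N => (hN N).symm
  have key := tendsto_nhds_unique hLlim hLlim'
  -- ### conclusion
  rw [intervalIntegral.integral_of_le ht.1.le]
  simp only [FunctionSpaces.Torus.kineticEnergy]
  linarith

/-! ### The work of the force and the equality between two positive times -/

/-- **The work of an `L¹(0,T;L²)` force is integrable in time** along an energy-class field with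
`L²` slices: `s ↦ ∫⟪f(s), u(s)⟫` is integrable on `(0, T)` (bound `C^{1/2}‖f(s)‖₂`). [folklore] -/
theorem integrableOn_work_L1L2 (hw : IsWeakNSSolutionForcedOn T ν f u₀ u)
    (hE : ∃ C : ℝ≥0, ∀ᵐ t ∂(volume.restrict (Ioo 0 T)), ∫⁻ x, ‖u t x‖ₑ ^ 2 ≤ C)
    (hL2 : ∀ t ∈ Icc 0 T, MemLp (u t) 2 volume)
    (hfm : AEStronglyMeasurable (FunctionSpaces.Torus.stLift f) (volume.restrict (Ioo 0 T ×ˢ univ)))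
    (hf : MemLqLp 1 2 f (Ioo 0 T)) :
    IntegrableOn (fun s => ∫ x, ⟪f s x, u s x⟫) (Ioo 0 T) := by
  set μT : Measure ℝ := volume.restrict (Ioo 0 T) with hμT
  obtain ⟨hfs, hNint⟩ := force_L1L2_bookkeeping hfm hf
  obtain ⟨C₀, hC₀⟩ := hE
  have hu' := aestronglyMeasurable_uncurry hw
  have hf' : AEStronglyMeasurable (uncurry f) (μT.prod volume) := by
    have h := FunctionSpaces.Torus.aestronglyMeasurable_uncurry_of_stLift_restrict hfm
    rwa [Measure.volume_eq_prod, ← Measure.prod_restrict, Measure.restrict_univ] at h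
  have hmeas : AEStronglyMeasurable (fun s => ∫ x, ⟪f s x, u s x⟫) μT := by
    have h1 : AEStronglyMeasurable (fun p : ℝ × UnitAddTorus d => ⟪uncurry f p, uncurry u p⟫) (μT.prod volume) :=
      hf'.inner hu'
    exact h1.integral_prod_right'
  set K : ℝ≥0∞ := (C₀ : ℝ≥0∞) ^ (1 / 2 : ℝ) with hK
  have hKtop : K ≠ ⊤ := ENNReal.rpow_ne_top_of_nonneg (by norm_num) ENNReal.coe_ne_top
  refine ⟨hmeas, ?_⟩
  refine HasFiniteIntegral.mono' (g := fun s => K.toReal * (eLpNorm (f s) 2 volume).toReal)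
    (hNint.const_mul _).hasFiniteIntegral ?_
  filter_upwards [hC₀, hfs, ae_restrict_mem measurableSet_Ioo] with s hC hfs2 hs
  have hmem : MemLp (u s) 2 volume := hL2 s (Ioo_subset_Icc_self hs)
  have huK : eLpNorm (u s) 2 volume ≤ K := by
    rw [hK, eLpNorm_eq_lintegral_rpow_enorm_toReal two_ne_zero ENNReal.ofNat_ne_top, ENNReal.toReal_ofNat]
    simp only [ENNReal.rpow_two]
    exact ENNReal.rpow_le_rpow hC (by norm_num)
  have h1 := enorm_integral_inner_le_eLpNorm_two_mul hfs2.1 hmem.1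
  have h2 : ‖∫ x, ⟪f s x, u s x⟫‖ₑ ≤ eLpNorm (f s) 2 volume * K := h1.trans (mul_le_mul' le_rfl huK)
  have hfin : eLpNorm (f s) 2 volume * K ≠ ⊤ := ENNReal.mul_ne_top hfs2.eLpNorm_ne_top hKtop
  have h3 := ENNReal.toReal_mono hfin h2
  rw [Real.enorm_eq_ofReal_abs, ENNReal.toReal_ofReal (abs_nonneg _), ← Real.norm_eq_abs,
    ENNReal.toReal_mul] at h3
  linarith [h3]

omit [Fintype d] [DecidableEq d] in
/-- Interval integrability from `0` of a function integrable on `(0, T)`, up to any `0 ≤ b ≤ T`. [folklore] -/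
theorem intervalIntegrable_of_integrableOn_Ioo {W : ℝ → ℝ} (hW : IntegrableOn W (Ioo 0 T)) {b : ℝ}
    (hb0 : 0 ≤ b) (hb : b ≤ T) : IntervalIntegrable W volume 0 b :=
  (intervalIntegrable_iff_integrableOn_Ioo_of_le hb0).2 (hW.mono_set (Ioo_subset_Ioo le_rfl hb))

/-- **The energy equality between two positive times**: under the hypotheses of
`energy_eq_zero`, for `0 < s ≤ t ≤ T`,
`½‖u(t)‖² + ν ∫ₛᵗ ‖∇u‖₂² = ½‖u(s)‖² + ∫ₛᵗ∫ ⟪f, u⟫` (difference of the equalities from `0`;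
Temam 1984, Ch. III, Thm. 3.2). [cite: Temam1984, Ch. III §3 Thm. 3.2] -/
theorem energy_eq_of_mem_Ioc (hd2 : 2 ≤ Fintype.card d) (hd4 : Fintype.card d ≤ 4)
    (hw : IsWeakNSSolutionForcedOn T ν f u₀ u)
    (hE : ∃ C : ℝ≥0, ∀ᵐ t ∂(volume.restrict (Ioo 0 T)), ∫⁻ x, ‖u t x‖ₑ ^ 2 ≤ C)
    (hL2 : ∀ t ∈ Icc 0 T, MemLp (u t) 2 volume)
    (hH1 : FunctionSpaces.Torus.MemL2Sobolev 0 T 1 (fun t => FunctionSpaces.EuclideanSpace.complexify ∘ u t))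
    (hwc : ∀ w : UnitAddTorus d → EuclideanSpace ℝ d, MemLp w 2 volume →
      ContinuousOn (fun t => ∫ x, ⟪u t x, w x⟫) (Ioc 0 T) ∧
        Tendsto (fun t => ∫ x, ⟪u t x, w x⟫) (𝓝[>] 0) (𝓝 (∫ x, ⟪u₀ x, w x⟫)))
    (hu₀ : MemLp u₀ 2 volume) (hL4 : ∫⁻ s in Ioo 0 T, ∫⁻ x, ‖u s x‖ₑ ^ 4 < ⊤)
    (hfm : AEStronglyMeasurable (FunctionSpaces.Torus.stLift f) (volume.restrict (Ioo 0 T ×ˢ univ)))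
    (hf : MemLqLp 1 2 f (Ioo 0 T)) {s : ℝ} (hs : s ∈ Ioc 0 T) {t : ℝ} (ht : t ∈ Icc s T) :
    FunctionSpaces.Torus.kineticEnergy (u t) + ν * (∫⁻ τ in Ioo s t, FunctionSpaces.Torus.eGradNormSq (u τ)).toReal =
      FunctionSpaces.Torus.kineticEnergy (u s) + ∫ τ in s..t, ∫ x, ⟪f τ x, u τ x⟫ := by
  have htT : t ∈ Ioc 0 T := ⟨hs.1.trans_le ht.1, ht.2⟩
  have het := energy_eq_zero hd2 hd4 hw hE hL2 hH1 hwc hu₀ hL4 hfm hf t htT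
  have hes := energy_eq_zero hd2 hd4 hw hE hL2 hH1 hwc hu₀ hL4 hfm hf s hs
  -- the dissipation splits at `s`
  have hfinT : ∫⁻ τ in Ioo 0 T, FunctionSpaces.Torus.eGradNormSq (u τ) < ⊤ :=
    lintegral_eGradNormSq_lt_top_of_memL2Sobolev hH1
  have hfin : ∀ {a b : ℝ}, 0 ≤ a → b ≤ T → ∫⁻ τ in Ioo a b, FunctionSpaces.Torus.eGradNormSq (u τ) ≠ ⊤ :=
    fun ha hb => ((lintegral_mono' (Measure.restrict_mono (Ioo_subset_Ioo ha hb) le_rfl) le_rfl).trans_lt hfinT).ne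
  have hsplit : ∫⁻ τ in Ioo 0 t, FunctionSpaces.Torus.eGradNormSq (u τ) =
      (∫⁻ τ in Ioo 0 s, FunctionSpaces.Torus.eGradNormSq (u τ)) + ∫⁻ τ in Ioo s t, FunctionSpaces.Torus.eGradNormSq (u τ) := by
    rw [← Ioo_union_Ico_eq_Ioo hs.1 ht.1, lintegral_union measurableSet_Ico
      (Set.disjoint_left.2 fun x hx hx' => hx.2.not_ge hx'.1), setLIntegral_congr Ioo_ae_eq_Ico.symm]
  have hD : (∫⁻ τ in Ioo 0 t, FunctionSpaces.Torus.eGradNormSq (u τ)).toReal =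
      (∫⁻ τ in Ioo 0 s, FunctionSpaces.Torus.eGradNormSq (u τ)).toReal +
        (∫⁻ τ in Ioo s t, FunctionSpaces.Torus.eGradNormSq (u τ)).toReal := by
    rw [hsplit, ENNReal.toReal_add (hfin le_rfl hs.2) (hfin hs.1.le ht.2)]
  -- the work splits at `s`
  have hW := integrableOn_work_L1L2 hw hE hL2 hfm hf
  have hWsplit : ∫ τ in s..t, ∫ x, ⟪f τ x, u τ x⟫ =
      (∫ τ in (0 : ℝ)..t, ∫ x, ⟪f τ x, u τ x⟫) - ∫ τ in (0 : ℝ)..s, ∫ x, ⟪f τ x, u τ x⟫ :=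
    (intervalIntegral.integral_interval_sub_left (intervalIntegrable_of_integrableOn_Ioo hW (hs.1.le.trans ht.1) ht.2)
      (intervalIntegrable_of_integrableOn_Ioo hW hs.1.le hs.2)).symm
  rw [hWsplit]
  rw [hD] at het
  linarith [het, hes]

end WeakNSEnergyClass

end Torus

end Literature.Analysis.FluidPDE

end
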